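import Summits.QuantumAdvantage.QuantumAdvantage.Theorems.NearExactIsExact.Negative.HyperplaneSupport

/-!
# `NearExactIsExact` (stmt-QuantumAdvantage-14043) — negative-side tool (disprove, gen 21):
  the DEFECT-ENERGY IDENTITY and the TWO-SIDED HYPERPLANE LEAK BOUND (no bentness, no degree hypothesis)

For ANY Boolean `f, g` on `N` bits, with `K = √(2^N)` and `σ_f = (-1)^f`,

  `Σ_z (W_g(z) − K σ_f(z))² = 2·(2^N)²·(1 − Φ(f, g))`                    (`hl_defect_energy`)

(Parseval + `Φ = Σ σ_f W_g / (2^N K)`): the forrelation defect `1 − Φ` is the `ℓ²` distance of the Walsh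
transform of `g` from the scaled sign pattern of `f`.  Slicing along the last coordinate (`N = n + 1`,
`g₀ = g(·‖0)`, `g₁ = g(·‖1)`, `W_g(u‖a) = W_{g₀}(u) + (-1)^a W_{g₁}(u)`, `HyperplaneSupport.hs_W_append`) and
minimising the two-term quadratic per `u` gives the LEAK BOUND (`hl_leak_le`):

  `Σ_{u : f(u‖0) ≠ f(u‖1)} W_{g₀}(u)²  +  Σ_{u : f(u‖0) = f(u‖1)} W_{g₁}(u)²  ≤  (2^{n+1})² (1 − Φ(f, g))`.

Each restriction has total energy `Σ_u W_{g_a}(u)² = 4ⁿ = (2^{n+1})²/4` (`hl_slice_energy`), so a pair with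
`Φ ≥ 1 − ε` has BOTH restrictions of `g` spectrally concentrated, up to a fraction `4ε` of their energy, on two
complementary sets determined by the partner: writing `D f = f(·‖0) ⊕ f(·‖1)`, the spectrum of `g₀` lives
(essentially) on `{D f = 0}` and that of `g₁` on `{D f = 1}`; for cubic `f` these are complementary QUADRICS
(or affine sets).  At `Φ = 1` the leak vanishes (`hl_exact_null₀`, `hl_exact_null₁`): in every exact pair, along
every coordinate, `W_{g₀}(u) = 0` wherever `f(u‖0) ≠ f(u‖1)` and `W_{g₁}(u) = 0` wherever `f(u‖0) = f(u‖1)`.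
This is the two-sided, bent-free form of the hyperplane test of `HyperplaneSupport` (there `g` is bent, the two
supports are exactly complementary, and the bound sharpens by a factor `2` through the sign terms).  Use in the cell: DISPROOF.md §28 (a necessary condition that
any near-exact NON-bent cubic pair must satisfy on all `2(n+1)` coordinate restrictions; it is what a two-sided
search has to aim at).  HONEST FRAMING: an identity / structural constraint (value = theorem), NOT summit
progress; it neither proves nor refutes `NearExactIsExact`.  Standard axioms. [folklore]
-/

set_option linter.dupNamespace false -- D-0017: single-problem summit ⇒ `QuantumAdvantage.QuantumAdvantage` by design

noncomputable section

namespace Summit.QuantumAdvantage.QuantumAdvantage.Theorems.NearExactIsExact.Negative.HyperplaneLeak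

open Finset
open Literature.Computability.QuantumComplexity
open Literature.Computability.QuantumComplexity.BuzetChailloux (phi_signOf signOf_sq)
open Literature.Computability.QuantumComplexity.DerivativeWalsh (W fsum phi_eq_fsum fsum_eq_sum_mul_W
  sqrt_two_pow_three_mul sum_W_sq)
open Literature.Computability.QuantumComplexity.SgnForrMem (signOf_false signOf_true)
open Summit.QuantumAdvantage.QuantumAdvantage.Theorems.NearExactIsExact.Negative.HyperplaneSupport
  (hs_W_append hs_sum_fin_one)

variable {n : ℕ}

/-! ### The defect-energy identity (any `N`, any `f, g`) -/

/-- `Σ_z σ_f(z) W_g(z) = 2^N √(2^N) Φ(f,g)`. [cite: AaronsonAmbainis2018, §1.1.1] -/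
theorem hl_sum_signOf_mul_W {N : ℕ} (f g : (Fin N → Bool) → Bool) :
    ∑ z, signOf (f z) * W (fun y => signOf (g y)) z =
      (2 : ℝ) ^ N * Real.sqrt ((2 : ℝ) ^ N) * forrelation f g := by
  rw [← phi_signOf, phi_eq_fsum, fsum_eq_sum_mul_W, sqrt_two_pow_three_mul]
  have h : (0 : ℝ) < (2 : ℝ) ^ N * Real.sqrt ((2 : ℝ) ^ N) := by positivity
  field_simp

/-- **Defect-energy identity.** For all Boolean `f, g` on `N` bits,
`Σ_z (W_g(z) − √(2^N)·(-1)^{f z})² = 2·(2^N)²·(1 − Φ(f,g))`. [folklore] -/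
theorem hl_defect_energy {N : ℕ} (f g : (Fin N → Bool) → Bool) :
    ∑ z, (W (fun y => signOf (g y)) z - Real.sqrt ((2 : ℝ) ^ N) * signOf (f z)) ^ 2 =
      2 * ((2 : ℝ) ^ N) ^ 2 * (1 - forrelation f g) := by
  have hK : Real.sqrt ((2 : ℝ) ^ N) ^ 2 = (2 : ℝ) ^ N := Real.sq_sqrt (by positivity)
  have e : ∀ z : Fin N → Bool,
      (W (fun y => signOf (g y)) z - Real.sqrt ((2 : ℝ) ^ N) * signOf (f z)) ^ 2 =
        W (fun y => signOf (g y)) z ^ 2 +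
          (-2 * Real.sqrt ((2 : ℝ) ^ N)) * (signOf (f z) * W (fun y => signOf (g y)) z) +
            Real.sqrt ((2 : ℝ) ^ N) ^ 2 * signOf (f z) ^ 2 := fun z => by ring
  simp_rw [e, signOf_sq]
  rw [sum_add_distrib, sum_add_distrib, ← mul_sum, ← mul_sum, hl_sum_signOf_mul_W, sum_W_sq]
  simp_rw [signOf_sq]
  rw [sum_const, card_univ, Fintype.card_fun, Fintype.card_bool, Fintype.card_fin, nsmul_eq_mul, hK]
  have h3 : Real.sqrt ((2 : ℝ) ^ N) * ((2 : ℝ) ^ N * Real.sqrt ((2 : ℝ) ^ N)) = (2 : ℝ) ^ N * (2 : ℝ) ^ N := by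
    rw [mul_left_comm, ← sq, hK]
  push_cast
  linear_combination (-2 * forrelation f g) * h3

/-! ### Slicing: the two-sided leak bound along the last coordinate -/

/-- Per-fibre inequality: for reals `A, B, K` and Booleans `a₀, a₁`,
`(A + B − Kσ₀)² + (A − B − Kσ₁)² ≥ 2·(leak)`, where the leak is `A²` if `a₀ ≠ a₁` and `B²` if `a₀ = a₁`
(`σᵢ = (-1)^{aᵢ}`). -/
theorem hl_fibre_le (A B K : ℝ) (a₀ a₁ : Bool) :
    2 * ((if a₀ ≠ a₁ then A ^ 2 else 0) + (if a₀ = a₁ then B ^ 2 else 0)) ≤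
      (A + signOf false * B - K * signOf a₀) ^ 2 + (A + signOf true * B - K * signOf a₁) ^ 2 := by
  rw [signOf_false, signOf_true]
  cases a₀ <;> cases a₁ <;> simp only [signOf] <;> norm_num <;>
    nlinarith [sq_nonneg (A - K), sq_nonneg (A + K), sq_nonneg (B - K), sq_nonneg (B + K)]

/-- **Two-sided hyperplane leak bound.** For ALL Boolean `f, g` on `n + 1` bits:
the Walsh energy of `g(·‖0)` on `{u : f(u‖0) ≠ f(u‖1)}` plus the Walsh energy of `g(·‖1)` on
`{u : f(u‖0) = f(u‖1)}` is at most `(2^{n+1})²·(1 − Φ(f,g))`. [folklore] -/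
theorem hl_leak_le (f g : (Fin (n + 1) → Bool) → Bool) :
    (∑ u ∈ univ.filter (fun u : Fin n → Bool =>
        f (Fin.append u fun _ => false) ≠ f (Fin.append u fun _ => true)),
        W (fun y => signOf (g (Fin.append y fun _ => false))) u ^ 2) +
      (∑ u ∈ univ.filter (fun u : Fin n → Bool =>
        f (Fin.append u fun _ => false) = f (Fin.append u fun _ => true)),
        W (fun y => signOf (g (Fin.append y fun _ => true))) u ^ 2) ≤
      ((2 : ℝ) ^ (n + 1)) ^ 2 * (1 - forrelation f g) := by
  have hE := hl_defect_energy f g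
  rw [sum_append] at hE
  simp_rw [hs_sum_fin_one, hs_W_append] at hE
  rw [sum_filter, sum_filter, ← sum_add_distrib]
  have key : ∀ u : Fin n → Bool,
      2 * ((if f (Fin.append u fun _ => false) ≠ f (Fin.append u fun _ => true) then
              W (fun y => signOf (g (Fin.append y fun _ => false))) u ^ 2 else 0) +
           (if f (Fin.append u fun _ => false) = f (Fin.append u fun _ => true) then
              W (fun y => signOf (g (Fin.append y fun _ => true))) u ^ 2 else 0)) ≤
        (W (fun y => signOf (g (Fin.append y fun _ => false))) u +
              signOf false * W (fun y => signOf (g (Fin.append y fun _ => true))) u -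
            Real.sqrt ((2 : ℝ) ^ (n + 1)) * signOf (f (Fin.append u fun _ => false))) ^ 2 +
          (W (fun y => signOf (g (Fin.append y fun _ => false))) u +
              signOf true * W (fun y => signOf (g (Fin.append y fun _ => true))) u -
            Real.sqrt ((2 : ℝ) ^ (n + 1)) * signOf (f (Fin.append u fun _ => true))) ^ 2 :=
    fun u => hl_fibre_le _ _ _ _ _
  have hs := sum_le_sum fun u (_ : u ∈ (univ : Finset (Fin n → Bool))) => key u
  rw [← mul_sum, hE] at hs
  linarith

/-- **Exact pairs, slice `0`.** If `Φ(f,g) = 1` then `W_{g(·‖0)}(u) = 0` at every `u` with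
`f(u‖0) ≠ f(u‖1)` (any `f, g`; for cubic `f` the complement of a quadric). [folklore] -/
theorem hl_exact_null₀ (f g : (Fin (n + 1) → Bool) → Bool) (h1 : forrelation f g = 1)
    (u : Fin n → Bool) (hu : f (Fin.append u fun _ => false) ≠ f (Fin.append u fun _ => true)) :
    W (fun y => signOf (g (Fin.append y fun _ => false))) u = 0 := by
  have hL := hl_leak_le f g
  rw [h1, sub_self, mul_zero] at hL
  have h0 : ∀ v ∈ univ.filter (fun u : Fin n → Bool =>
      f (Fin.append u fun _ => false) ≠ f (Fin.append u fun _ => true)),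
      0 ≤ W (fun y => signOf (g (Fin.append y fun _ => false))) v ^ 2 := fun v _ => sq_nonneg _
  have h1' : ∀ v ∈ univ.filter (fun u : Fin n → Bool =>
      f (Fin.append u fun _ => false) = f (Fin.append u fun _ => true)),
      0 ≤ W (fun y => signOf (g (Fin.append y fun _ => true))) v ^ 2 := fun v _ => sq_nonneg _
  have hA := sum_nonneg h0
  have hB := sum_nonneg h1'
  have hA0 : ∑ v ∈ univ.filter (fun u : Fin n → Bool =>
      f (Fin.append u fun _ => false) ≠ f (Fin.append u fun _ => true)),
      W (fun y => signOf (g (Fin.append y fun _ => false))) v ^ 2 = 0 := by linarith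
  have hmem : u ∈ univ.filter (fun u : Fin n → Bool =>
      f (Fin.append u fun _ => false) ≠ f (Fin.append u fun _ => true)) := by
    rw [mem_filter]; exact ⟨mem_univ _, hu⟩
  have := (sum_eq_zero_iff_of_nonneg h0).1 hA0 u hmem
  exact pow_eq_zero_iff (n := 2) (by norm_num) |>.1 this

/-- **Exact pairs, slice `1`.** If `Φ(f,g) = 1` then `W_{g(·‖1)}(u) = 0` at every `u` with
`f(u‖0) = f(u‖1)`. [folklore] -/
theorem hl_exact_null₁ (f g : (Fin (n + 1) → Bool) → Bool) (h1 : forrelation f g = 1)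
    (u : Fin n → Bool) (hu : f (Fin.append u fun _ => false) = f (Fin.append u fun _ => true)) :
    W (fun y => signOf (g (Fin.append y fun _ => true))) u = 0 := by
  have hL := hl_leak_le f g
  rw [h1, sub_self, mul_zero] at hL
  have h0 : ∀ v ∈ univ.filter (fun u : Fin n → Bool =>
      f (Fin.append u fun _ => false) ≠ f (Fin.append u fun _ => true)),
      0 ≤ W (fun y => signOf (g (Fin.append y fun _ => false))) v ^ 2 := fun v _ => sq_nonneg _
  have h1' : ∀ v ∈ univ.filter (fun u : Fin n → Bool =>
      f (Fin.append u fun _ => false) = f (Fin.append u fun _ => true)),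
      0 ≤ W (fun y => signOf (g (Fin.append y fun _ => true))) v ^ 2 := fun v _ => sq_nonneg _
  have hA := sum_nonneg h0
  have hB := sum_nonneg h1'
  have hB0 : ∑ v ∈ univ.filter (fun u : Fin n → Bool =>
      f (Fin.append u fun _ => false) = f (Fin.append u fun _ => true)),
      W (fun y => signOf (g (Fin.append y fun _ => true))) v ^ 2 = 0 := by linarith
  have hmem : u ∈ univ.filter (fun u : Fin n → Bool =>
      f (Fin.append u fun _ => false) = f (Fin.append u fun _ => true)) := by
    rw [mem_filter]; exact ⟨mem_univ _, hu⟩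
  have := (sum_eq_zero_iff_of_nonneg h1').1 hB0 u hmem
  exact pow_eq_zero_iff (n := 2) (by norm_num) |>.1 this

/-- **Energy budget of a restriction** (Parseval): `Σ_u W_{g(·‖a)}(u)² = (2ⁿ)²`, a quarter of the
right-hand side scale `(2^{n+1})²` of `hl_leak_le` — so `Φ ≥ 1 − ε` forces relative leak `≤ 4ε`. [folklore] -/
theorem hl_slice_energy (g : (Fin (n + 1) → Bool) → Bool) (a : Bool) :
    ∑ u, W (fun y => signOf (g (Fin.append y fun _ => a))) u ^ 2 = ((2 : ℝ) ^ n) ^ 2 := by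
  rw [sum_W_sq]
  simp_rw [signOf_sq]
  rw [sum_const, card_univ, Fintype.card_fun, Fintype.card_bool, Fintype.card_fin, nsmul_eq_mul]
  push_cast
  ring

end Summit.QuantumAdvantage.QuantumAdvantage.Theorems.NearExactIsExact.Negative.HyperplaneLeak

end
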